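import Mathlib
import Summits.NavierStokesRegularity.NavierStokesRegularity.Theses.FilamentSkeletonRss
import Summits.NavierStokesRegularity.NavierStokesRegularity.Theorems.FilamentSkeletonRssSelectionBoxRJRungNormalBlockBox

/-!
# Route `FilamentSkeletonRss` · crux `SelectionBoxRJ` (stmt-NavierStokesRegularity-21220) — census:
# the selection box WITHOUT clause 12 (and with `2Kρ ≤ 1`) implies `SelectionBoxRJ`

Lane `ns-filament-19175-p1` (g8).  `--supports stmt-NavierStokesRegularity-21220`.  The SURVIVING REDUCED STATEMENT of the
∃-crux on the clause-12 axis: `selectionBoxRJ_of_noClause12` — if there are box constants with `2Kρ ≤ 1` and, for all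
large `Γ`, an `N`-parameter box of skeletons satisfying every clause of `SelectionBoxRJ` EXCEPT clause 12 (the hyperbolic
normal block `Orthonormal (X′(c), m, n) ∧ ⟪A m, m⟫ + ⟪A n, n⟫ < 0 ∧ ⟪A n, m⟫⟪A m, n⟫ < ⟪A m, m⟫⟪A n, n⟫`; the binders
`m, n, A` are dropped with it) together with the sign law, then `SelectionBoxRJ` holds: raise `Γ₂` to the explicit
threshold `Γ₁₂` of `…RungNormalBlockBox.clause12_of_skeleton`, complete each tangent `X_j′(c_j)` to an orthonormal frame
(`exists_orthonormal_frame`), and read clause 12 off the other clauses.  The hypothesis is the text of `SelectionBoxRJ`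
(route file rev 13) with exactly these edits: binders `(m n …)`, `(A …)` and the hypothesis `A p j = fderiv ℝ (v p) …`
removed, the clause-12 conjunct removed, `2*K*ρ ≤ 1` added to the constants.  So a witness of the crux never has to
compute a velocity GRADIENT; the separation constant `ρ` may always be lowered to meet `2Kρ ≤ 1`.

PLANNER-FACING (no route edit implied): a retype of `SelectionBoxRJ` to this flat form keeps the glue, since
`BoxSelectionRJ` re-threads through `selectionBoxRJ_of_noClause12`.

HONEST FRAMING.  Bookkeeping about a HYPOTHETICAL filament box; nothing here is a claim about Navier–Stokes regularity
or blow-up.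
-/

set_option linter.dupNamespace false

noncomputable section

namespace Summit.NavierStokesRegularity.NavierStokesRegularity.Theorems

open Set Function Filter MeasureTheory Real
open Literature.Analysis.FluidPDE
open Summit.NavierStokesRegularity.NavierStokesRegularity.Theses.FilamentSkeletonRss
open scoped InnerProductSpace Topology

namespace SelectionBoxRJRung

/-- Every unit vector of `ℝ³` is the first leg of an orthonormal frame: `m = (t × e)/‖t × e‖` for a coordinate vector `e`
with `‖t × e‖² ≥ 1/2`, `n = t × m`. [folklore] -/
theorem exists_orthonormal_frame {t : EuclideanSpace ℝ (Fin 3)} (ht : ‖t‖ = 1) :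
    ∃ m n : EuclideanSpace ℝ (Fin 3), Orthonormal ℝ ![t, m, n] := by
  have hperp1 : ∀ a b : EuclideanSpace ℝ (Fin 3), ⟪a, cross a b⟫_ℝ = 0 := fun a b => by
    simp [cross, crossProduct, PiLp.inner_apply, Fin.sum_univ_three]; ring
  have hperp2 : ∀ a b : EuclideanSpace ℝ (Fin 3), ⟪b, cross a b⟫_ℝ = 0 := fun a b => by
    simp [cross, crossProduct, PiLp.inner_apply, Fin.sum_univ_three]; ring
  -- a coordinate vector `e` with `‖t × e‖² ≥ 1/2`
  have hsq : t 0 ^ 2 + t 1 ^ 2 ≤ 1 := by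
    have h := EuclideanSpace.norm_sq_eq t
    rw [ht, one_pow, Fin.sum_univ_three] at h
    simp only [Real.norm_eq_abs, sq_abs] at h
    nlinarith [sq_nonneg (t 2)]
  have hcand : ∀ i : Fin 3, ‖cross t (EuclideanSpace.single i 1)‖ ^ 2 = 1 - t i ^ 2 := fun i => by
    rw [norm_cross_sq, ht, PiLp.norm_single, norm_one, EuclideanSpace.inner_single_right]; simp
  obtain ⟨e, he⟩ : ∃ e : EuclideanSpace ℝ (Fin 3), 1 / 2 ≤ ‖cross t e‖ ^ 2 := by
    rcases le_or_gt (t 0 ^ 2) (1 / 2) with h0 | h0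
    · exact ⟨EuclideanSpace.single 0 1, by rw [hcand 0]; linarith⟩
    · exact ⟨EuclideanSpace.single 1 1, by rw [hcand 1]; linarith⟩
  have hx0 : 0 < ‖cross t e‖ := by
    rcases (norm_nonneg (cross t e)).lt_or_eq with h | h
    · exact h
    · rw [← h] at he; norm_num at he
  set m : EuclideanSpace ℝ (Fin 3) := (‖cross t e‖)⁻¹ • cross t e with hm
  have hmn : ‖m‖ = 1 := by
    rw [hm, norm_smul, Real.norm_of_nonneg (inv_nonneg.2 hx0.le), inv_mul_cancel₀ hx0.ne']
  have htm : ⟪t, m⟫_ℝ = 0 := by rw [hm, real_inner_smul_right, hperp1, mul_zero]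
  set n : EuclideanSpace ℝ (Fin 3) := cross t m with hn
  have hnn : ‖n‖ = 1 := by
    have h := norm_cross_sq t m
    rw [ht, hmn, htm] at h
    have h1 : ‖cross t m‖ ^ 2 = 1 := by rw [h]; norm_num
    have h2 := norm_nonneg (cross t m)
    rw [hn]; nlinarith
  have htn : ⟪t, n⟫_ℝ = 0 := by rw [hn]; exact hperp1 t m
  have hmn' : ⟪m, n⟫_ℝ = 0 := by rw [hn]; exact hperp2 t m
  refine ⟨m, n, ?_⟩
  rw [orthonormal_vecCons_iff, orthonormal_vecCons_iff, orthonormal_vecCons_iff]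
  refine ⟨ht, fun i => ?_, hmn, fun i => ?_, hnn, fun i => i.elim0, Orthonormal.of_isEmpty _⟩
  · fin_cases i <;> simp [htm, htn]
  · fin_cases i; simp [hmn']

end SelectionBoxRJRung

open SelectionBoxRJRung in
/-- **The selection box without clause 12 implies `SelectionBoxRJ`** (regime `2Kρ ≤ 1`).  See the module docstring.
[folklore] -/
theorem selectionBoxRJ_of_noClause12
    (h : (open Literature.Analysis.FluidPDE in ∃ (N:ℕ) (δ ρ K Λ a b cnd η Rw Rb cg θ₀ Γ₂:ℝ), 0 < N ∧ 0 < δ ∧ 0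
      < ρ ∧ 0 ≤ a ∧ 0 < cnd ∧ 0 < η ∧ 0 < Rw ∧ 0 < Rb ∧ 0 < cg ∧ 0 < θ₀ ∧ 2*K*ρ ≤ 1 ∧ ∀ Γ:ℝ, Γ₂≤Γ → ∃
      (γ:(Fin N→ℝ) → Fin N → ℝ) (α:(Fin N→ℝ) → ℝ) (X:(Fin N→ℝ) → Fin N → ℝ → EuclideanSpace ℝ (Fin 3))
      (w:(Fin N→ℝ) → Fin N → ℝ → ℝ) (c:(Fin N→ℝ) → Fin N → ℝ), ∀ (u:(Fin N→ℝ)→(Fin N → ℝ → EuclideanSpace ℝ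
      (Fin 3)) → EuclideanSpace ℝ (Fin 3) → EuclideanSpace ℝ (Fin 3)) (v:(Fin N→ℝ) → EuclideanSpace ℝ (Fin
      3) → EuclideanSpace ℝ (Fin 3)) (T:(Fin N→ℝ)→(Fin N → ℝ → EuclideanSpace ℝ (Fin 3)) → Fin N → ℝ →
      EuclideanSpace ℝ (Fin 3)) (D:(Fin N→ℝ) → Fin N → EuclideanSpace ℝ (Fin 3) → EuclideanSpace ℝ (Fin
      3)), (∀ p Z y, u p Z y = ∑ k, (Γ*γ p k/(4*Real.pi))•∫ σ:ℝ, ((‖y-Z k σ‖^2+1)^(3/2:ℝ))⁻¹•cross (deriv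
      (Z k) σ) (y-Z k σ))→(∀ p y, v p y = u p (X p) y+(1/2:ℝ)•y-α p•cross (EuclideanSpace.single 2 1) y)→(∀
      p Z j τ, T p Z j τ = (u p Z (Z j τ)+(1/2:ℝ)•Z j τ-α p•cross (EuclideanSpace.single 2 1) (Z j τ))-(⟪u
      p Z (Z j τ)+(1/2:ℝ)•Z j τ-α p•cross (EuclideanSpace.single 2 1) (Z j τ), deriv (Z j) τ⟫_ℝ/‖deriv (Z
      j) τ‖^2)•deriv (Z j) τ)→(∀ p j y, D p j y = (Real.exp (-(⟪y-X p j (c p j), deriv (X p j) (c p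
      j)⟫_ℝ)^2)*((1-Real.exp (-(‖y-X p j (c p j)‖^2-⟪y-X p j (c p j), deriv (X p j) (c p j)⟫_ℝ^2)))/(‖y-X p
      j (c p j)‖^2-⟪y-X p j (c p j), deriv (X p j) (c p j)⟫_ℝ^2)))•cross (deriv (X p j) (c p j)) (y-X p j
      (c p j)))→((∀ j, ContinuousOn (fun q:(Fin N→ℝ) × ℝ => (α q.1, γ q.1 j, X q.1 j q.2, w q.1 j q.2))
      ({p:Fin N → ℝ | ∀ i, p i ∈ Icc 0 1} ×ˢ univ))∧(∀ p:Fin N → ℝ, (∀ i, p i ∈ Icc 0 1) → α p ≠ 0 ∧ (∀ j,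
      γ p j ≠ 0)∧(∀ j, ContDiff ℝ 2 (X p j) ∧ Differentiable ℝ (w p j)∧(∀ τ, ‖deriv (X p j) τ‖ = 1)∧(∀ τ,
      ‖iteratedDeriv 2 (X p j) τ‖*√Γ≤K) ∧ Tendsto (fun τ => ‖X p j τ‖) (cocompact ℝ) atTop)∧(∀ j k, j ≠ k →
      ∀ τ σ, ρ*√Γ≤‖X p j τ-X p k σ‖)∧(∀ j τ σ, ρ*√Γ≤|τ-σ| → cg*ρ*√Γ≤‖X p j τ-X p j σ‖)∧(∀ j τ, cg*|τ-c p
      j|≤Rw*√Γ+‖X p j τ‖)∧(∀ j τ, w p j τ = ⟪v p (X p j τ), deriv (X p j) τ⟫_ℝ)∧(∀ j τ, ‖X p j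
      τ‖≤Rb*√(Γ*Real.log Γ) → v p (X p j τ) = w p j τ•deriv (X p j) τ)∧(∀ j, ‖X p j (c p j)‖≤Rw*√Γ)∧(∀ j,
      |⟪deriv (X p j) (c p j), EuclideanSpace.single 2 1⟫_ℝ|≤1-θ₀)∧(θ₀≤|α p| ∧ |α p|≤θ₀⁻¹ ∧ ∀ j, θ₀≤|γ p j|
      ∧ |γ p j|≤θ₀⁻¹)∧(∀ j, w p j (c p j) = 0 ∧ (∀ τ, w p j τ = 0 → τ = c p j) ∧ 3/2+δ≤deriv (w p j) (c p
      j) ∧ deriv (w p j) (c p j)≤Λ)∧(∀ Y:Fin N → ℝ → EuclideanSpace ℝ (Fin 3), (∀ j, ContDiff ℝ 2 (Y j))→(∀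
      j τ, ⟪Y j τ, deriv (X p j) τ⟫_ℝ = 0) → (∀ j τ, Rb*√(Γ*Real.log Γ) < ‖X p j τ‖ → Y j τ = 0) → ∑ j, ⟪Y
      j (c p j), cross (EuclideanSpace.single 2 1) (X p j (c p j))⟫_ℝ = 0 → (∀ j τ, ‖Y j τ‖+‖deriv (Y j)
      τ‖+‖iteratedDeriv 2 (Y j) τ‖≤(1+|τ-c p j|)^b) → ∀ L:ℝ, (∀ j τ, ‖deriv (fun s:ℝ => T p (fun k σ => X p
      k σ+s•Y k σ) j τ) 0‖≤L*(1+|τ-c p j|)^a) → ∀ j τ, ‖Y j τ‖≤cnd*L*(1+|τ-c p j|)^b)))∧(∀ (C₀ M:ℝ) (U:(Fin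
      N→ℝ) → EuclideanSpace ℝ (Fin 3) → EuclideanSpace ℝ (Fin 3)) (P:(Fin N→ℝ) → EuclideanSpace ℝ (Fin 3) →
      ℝ) (B:(Fin N→ℝ) → Fin N → ℝ), (ContinuousOn B {p:Fin N → ℝ | ∀ i, p i ∈ Icc 0 1} ∧ ∀ p:Fin N → ℝ, (∀
      i, p i ∈ Icc 0 1) → U p ≠ 0 ∧ ContDiff ℝ (⊤:ℕ∞) (U p) ∧ ContDiff ℝ (⊤:ℕ∞) (P p) ∧
      VectorCalculus.IsDivFree (U p)∧(∀ y, α p•(cross (EuclideanSpace.single 2 1) (U p y)-fderiv ℝ (U p) y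
      (cross (EuclideanSpace.single 2 1) y))+(1/2:ℝ)•U p y+(1/2:ℝ)•fderiv ℝ (U p) y y-(Laplacian.laplacian
      (U p)) y+fderiv ℝ (U p) y (U p y)+gradient (P p) y = ∑ j, B p j•D p j y)∧(∀ y, ‖U p y‖≤C₀/(1+‖y‖))∧(∀
      y, |P p y|≤M)∧(∀ y, ‖y‖≤Rw*√Γ → (∀ j τ, ρ*√Γ/4≤‖y-X p j τ‖) → ‖U p y-u p (X p) y‖≤η*√Γ))→(∀ (j:Fin N)
      (p q:Fin N → ℝ), (∀ i, p i ∈ Icc 0 1)→(∀ i, q i ∈ Icc 0 1) → p j = 0 → q j = 1 → B p j*B q j < 0)))) :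
    SelectionBoxRJ := by
  obtain ⟨N, δ, ρ, K, Λ, a, b, cnd, η, Rw, Rb, cg, θ₀, Γ₂, hN, hδ, hρ, ha, hcnd, hη, hRw, hRb, hcg, hθ₀, hKρ, hbox⟩ := h
  -- the explicit threshold of `clause12_of_skeleton`
  obtain ⟨Γ₁₂, hΓ₁₂⟩ : ∃ Γ₁₂ : ℝ, Γ₁₂ = max (max (Real.exp ((Rw / Rb) ^ 2 + 1)) ((7104 * Real.pi * K) ^ 2))
      (max (312 * Real.pi * (cg * ρ + 2 * Rw) / (cg ^ 4 * ρ ^ 3))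
        (4 * Real.pi * (12 * N * (ρ + 2 * Rw) / (θ₀ * cg * ρ ^ 3) + 2 * θ₀⁻¹ + 2) / θ₀)) := ⟨_, rfl⟩
  refine ⟨N, δ, ρ, K, Λ, a, b, cnd, η, Rw, Rb, cg, θ₀, max Γ₂ Γ₁₂, hN, hδ, hρ, ha, hcnd, hη, hRw, hRb, hcg, hθ₀, ?_⟩
  intro Γ hΓ
  have hΓ₂ : Γ₂ ≤ Γ := (le_max_left _ _).trans hΓ
  have hΓ' : Γ₁₂ ≤ Γ := (le_max_right _ _).trans hΓ
  rw [hΓ₁₂] at hΓ'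
  have hΓ1 : Real.exp ((Rw / Rb) ^ 2 + 1) ≤ Γ := ((le_max_left _ _).trans (le_max_left _ _)).trans hΓ'
  have hΓ2 : (7104 * Real.pi * K) ^ 2 ≤ Γ := ((le_max_right _ _).trans (le_max_left _ _)).trans hΓ'
  have hΓ3 : 312 * Real.pi * (cg * ρ + 2 * Rw) / (cg ^ 4 * ρ ^ 3) ≤ Γ :=
    ((le_max_left _ _).trans (le_max_right _ _)).trans hΓ'
  have hΓ4 : 4 * Real.pi * (12 * N * (ρ + 2 * Rw) / (θ₀ * cg * ρ ^ 3) + 2 * θ₀⁻¹ + 2) / θ₀ ≤ Γ :=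
    ((le_max_right _ _).trans (le_max_right _ _)).trans hΓ'
  obtain ⟨γ, α, X, w, c, hX⟩ := hbox Γ hΓ₂
  -- orthonormal frames along the tangents (any choice; no continuity in `p` is required of `m, n`)
  have hfr : ∀ t : EuclideanSpace ℝ (Fin 3), ∃ mn : EuclideanSpace ℝ (Fin 3) × EuclideanSpace ℝ (Fin 3),
      ‖t‖ = 1 → Orthonormal ℝ ![t, mn.1, mn.2] := fun t => by
    by_cases ht : ‖t‖ = 1
    · obtain ⟨m, n, hmn⟩ := exists_orthonormal_frame ht
      exact ⟨(m, n), fun _ => hmn⟩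
    · exact ⟨(0, 0), fun h => absurd h ht⟩
  choose fr hfr using hfr
  refine ⟨γ, α, X, w, c, fun p j => (fr (deriv (X p j) (c p j))).1, fun p j => (fr (deriv (X p j) (c p j))).2, ?_⟩
  intro u v A T D hu hv hA hT hD
  obtain ⟨⟨hcont, hcl⟩, hsign⟩ := hX u v T D hu hv hT hD
  refine ⟨⟨hcont, fun p hp => ?_⟩, hsign⟩
  obtain ⟨hαp, hγp, hreg, hsep, hnoret, hesc, hwdef, htan, hwaist, htilt, hbds, hstag, h13⟩ := hcl p hp
  refine ⟨hαp, hγp, hreg, hsep, hnoret, hesc, hwdef, htan, hwaist, htilt, hbds, hstag, fun j => ?_, h13⟩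
  have hon := hfr (deriv (X p j) (c p j)) ((hreg j).2.2.1 (c p j))
  have h12 := clause12_of_skeleton hδ hρ hRw hRb hcg hθ₀ hKρ hΓ1 hΓ2 hΓ3 hΓ4 (hu p) (hv p)
    (fun k => ⟨(hreg k).1, (hreg k).2.1, (hreg k).2.2.1, (hreg k).2.2.2.1⟩) hsep hnoret hesc htan hwaist hbds
    (fun k => ⟨(hstag k).1, (hstag k).2.2.1⟩) j hon
  rw [hA p j]
  exact ⟨hon, h12.1, h12.2⟩

end Summit.NavierStokesRegularity.NavierStokesRegularity.Theorems
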